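import Summits.BirchSwinnertonDyer.BirchSwinnertonDyer.Theses.PAdicOrderV2
import Summits.BirchSwinnertonDyer.BirchSwinnertonDyer.Theses.SelmerRank
import Summits.BirchSwinnertonDyer.BirchSwinnertonDyer.Theorems.SelmerRankShaCorank
import Summits.BirchSwinnertonDyer.BirchSwinnertonDyer.Theorems.PAdicOrderV2PAdicOrderComparisonR2StubConstantCoeff
import Summits.BirchSwinnertonDyer.BirchSwinnertonDyer.Theorems.PAdicOrderV2PAdicOrderComparisonR2StubTwoLeOrder
import Summits.BirchSwinnertonDyer.BirchSwinnertonDyer.Theorems.PAdicOrderV2PAdicOrderComparisonR2StubKerMulTRatSqEq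
import Summits.BirchSwinnertonDyer.BirchSwinnertonDyer.Theorems.PAdicOrderV2PAdicOrderComparisonR2StubOrderEqSelmerCorank
import Summits.BirchSwinnertonDyer.BirchSwinnertonDyer.Theorems.PAdicOrderV2PAdicOrderComparisonR2OfItems
import Literature.NumberTheory.EllipticCurves.PAdicBSD
import Literature.NumberTheory.EllipticCurves.SelmerCorankControl
import Literature.NumberTheory.EllipticCurves.KatoRankBoundSelmerProofs
import Literature.NumberTheory.EllipticCurves.IwasawaSelmerDualProofs
import Literature.NumberTheory.EllipticCurves.SelmerInftyTorsionFiniteProofs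
import Literature.NumberTheory.EllipticCurves.OrdinaryPrimesProofs
import Summits.BirchSwinnertonDyer.BirchSwinnertonDyer.Theorems.PAdicOrderV2PAdicOrderComparisonR2OddOfItems

/-!
# Crux #2 `PAdicOrderComparisonR2` BY NAME from the route items, Mazur control, and the `p = 2`
# instances of the main conjecture and of `T`-semisimplicity (line `Sketch`, skeleton v11, lead c3 —
# helper file, `--supports stmt-BirchSwinnertonDyer-0489`)

Skeleton v11 of line `Sketch` (`Cruxes/PAdicOrderComparisonR2/Lines/Sketch.lean`) has three stubs:
CT (Mazur's control theorem in corank form, the rank clause of the named fact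
`Greenberg1999_coinvariantsRank_eq_selmerCorank_rat`) and the `p = 2` instances MC2 / SS2 of the route
items `PAdicOrderMainConjectureR7` (stmt-15426, which carries `3 ≤ p`) and `PAdicOrderSemisimpleR3`
(stmt-0509, which carries `p ≠ 2`). This file lands, sorry-free, the composition with those three
stubs turned into explicit hypotheses:

* `order_eq_analyticRank_of_mc_ss_control` — POINTWISE, at any good ordinary `(W, p)`, any `p`, any
  analytic rank: the main-conjecture conclusion and integral `T`-semisimplicity for every cyclotomic
  datum at `p`, Mazur control and route SelmerRank's four items give `ord_{T=0} L_p = r_an`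
  (`ord_T L_p = ord_T g = rank X/TX = corank Sel_{p^∞}(E/ℚ) = r_an`: the landed SS-bridge
  `stub_ker_mulTRat_sq_eq`, bookkeeping `stub_order_eq_selmerCorank` and Selmer side
  `selmerCorank_eq_analyticRank_of_selmerRankItems`, all parity-free);
* `pAdicOrderComparisonR2_of_items_control_two` — the CRUX BY NAME from the seven route items
  (0515, 0131, 0130, 14418, 0132, 0509, 15426), the Mazur-control fact, and the two `p = 2`
  statements MC2, SS2 (stated inline as hypotheses: they are instances of items, not new notions):
  odd `p` by the landed `pAdicOrderComparisonR2_odd_of_items` (p135381), `p = 2` by the pointwise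
  theorem. So crux #2 ⇐ items ∧ Mazur control ∧ IMC₂ ∧ semisimplicity₂, machine-checked; extending
  items 15426/0509 to `p = 2`, or restating the crux with `p ≠ 2 →`, leaves items ∧ Mazur control.

References: B. Mazur, J. Tate, J. Teitelbaum, Invent. Math. 84 (1986), §II.10; R. Greenberg, LNM 1716
(1999), Thm 1.2, §1 Conj. 1.12–1.13; K. Kato, Astérisque 295 (2004), Thm 17.4.
-/

-- the problem directory `BirchSwinnertonDyer/BirchSwinnertonDyer` forces the duplicated namespace segment
set_option linter.dupNamespace false

namespace Summit.BirchSwinnertonDyer.BirchSwinnertonDyer.Theorems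

open Summit.BirchSwinnertonDyer.BirchSwinnertonDyer.Theses.PAdicOrderV2
open Summit.BirchSwinnertonDyer.BirchSwinnertonDyer.Theses.SelmerRank (SelmerRankLB SelmerRankUB
  SelmerRankSmallImage SelmerRankShaPFinite)
open Literature.NumberTheory.EllipticCurves

/-- **`ord_{T=0} L_p = r_an` at a good ordinary `(W, p)` from the main conjecture, `T`-semisimplicity
and Mazur control AT THAT PRIME (pointwise; any prime `p`, any analytic rank).** Given, for every
cyclotomic datum `(κ, γ, D)` at `p`, the main-conjecture conclusion (`X` torsion, `char X = (g)`,
`ι g = p^k L_p`) and the integral `T`-semisimplicity of `X`, the named fact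
`Greenberg1999_coinvariantsRank_eq_selmerCorank_rat` (Mazur control in corank form, Greenberg LNM 1716
Thm 1.2, parity-free) and route SelmerRank's items: `ord_T L_p = ord_T g = rank_{ℤ_p} X/TX = corank
Sel_{p^∞}(E/ℚ)` (`stub_order_eq_selmerCorank` with the SS-bridge `stub_ker_mulTRat_sq_eq`) `= r_an`
(`selmerCorank_eq_analyticRank_of_selmerRankItems`). A cyclotomic datum exists by
`exists_isCyclotomic_isTopGenerator_isCyclotomicVariable_holds` / `nonempty_selmerDualData_holds`.
[cite: GreenbergLNM1716, Thm. 1.2 and §1 p. 65] -/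
theorem order_eq_analyticRank_of_mc_ss_control (hLB : SelmerRankLB) (hUB : SelmerRankUB)
    (hSI : SelmerRankSmallImage) (hSha : SelmerRankShaPFinite)
    (hCT : Greenberg1999_coinvariantsRank_eq_selmerCorank_rat) (W : WeierstrassCurve ℚ) [W.IsElliptic]
    [W.IsGloballyMinimal] (p : ℕ) [Fact p.Prime] (hord : IsOrdinaryAt W p) {N : ℕ} [NeZero N]
    (f : CuspForm (CongruenceSubgroup.Gamma0 N) 2)
    (hmc : ∀ (κ : ZpExtension ℚ p) (γ : Field.absoluteGaloisGroup ℚ), κ.IsCyclotomic →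
      κ.IsTopGenerator γ → IsCyclotomicVariable p γ → ∀ (D : W.SelmerDualData κ γ),
        D.IsTorsion ∧ ∃ (g : IwasawaAlgebra p) (k : ℤ), D.charIdeal = Ideal.span {g} ∧
          iwasawaToPowerSeries p g =
            PowerSeries.C ((p : ℚ_[p]) ^ k) * padicLFunction f (unitRoot W p : ℚ_[p]))
    (hss : ∀ (κ : ZpExtension ℚ p) (γ : Field.absoluteGaloisGroup ℚ), κ.IsCyclotomic →
      κ.IsTopGenerator γ → ∀ (D : W.SelmerDualData κ γ) (x : D.X),
        (∃ k : ℕ, (PowerSeries.C ((p : ℤ_[p]) ^ k) * PowerSeries.X ^ 2 : IwasawaAlgebra p) • x = 0) →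
          ∃ k : ℕ, (PowerSeries.C ((p : ℤ_[p]) ^ k) * PowerSeries.X : IwasawaAlgebra p) • x = 0) :
    (padicLFunction f (unitRoot W p : ℚ_[p])).order = W.analyticRank := by
  obtain ⟨κ, hκ, γ, hγ, hγ'⟩ := exists_isCyclotomic_isTopGenerator_isCyclotomicVariable_holds p
  obtain ⟨D⟩ := W.nonempty_selmerDualData_holds κ γ hγ
  obtain ⟨htors, hmc'⟩ := hmc κ γ hκ hγ hγ' D
  have hss' := stub_ker_mulTRat_sq_eq p D.X (hss κ γ hκ hγ D)
  have hctrl := (hCT W p hord.1 hord.2 κ γ hκ hγ D).2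
  have hoc := stub_order_eq_selmerCorank W p κ γ hκ hγ f D htors hmc' hss' hctrl
  rw [hoc, selmerCorank_eq_analyticRank_of_selmerRankItems hLB hUB hSI hSha W p]

/-- **Crux #2 `PAdicOrderComparisonR2` BY NAME from the seven route items, Mazur control, and the
`p = 2` instances of the main conjecture (MC2) and of `T`-semisimplicity (SS2).** Odd `p`: the landed
`pAdicOrderComparisonR2_odd_of_items` (items crux #5 `PAdicOrderRankOneR4`, `SelmerRankLB` /
`SelmerRankUB` / `SelmerRankSmallImage` / `SelmerRankShaPFinite`, crux #4 `PAdicOrderSemisimpleR3`,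
crux #7 `PAdicOrderMainConjectureR7`, and the control fact); `p = 2`:
`order_eq_analyticRank_of_mc_ss_control` fed by MC2 and SS2 — binder for binder the statements of
items 15426 / 0509 with `3 ≤ p` / `p ≠ 2` replaced by `p = 2` (beyond print at `p = 2`: Kato's half of
the IMC is printed parity-free, Astérisque 295 Thm 17.4 (1)(2); the converse divisibility only for odd
`p`, Skinner–Urban 2014 §1.1). Machine-checked content: crux #2 ⇐ items ∧ Mazur control ∧ IMC₂ ∧ SS₂.
[cite: MazurTateTeitelbaum1986Invent, §II.10] [cite: GreenbergLNM1716, §1 Conj. 1.12–1.13 (pp. 64–65)] -/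
theorem pAdicOrderComparisonR2_of_items_control_two :
    Summit.BirchSwinnertonDyer.BirchSwinnertonDyer.Theses.PAdicOrderV2.PAdicOrderRankOneR4 →
    Summit.BirchSwinnertonDyer.BirchSwinnertonDyer.Theses.SelmerRank.SelmerRankLB →
    Summit.BirchSwinnertonDyer.BirchSwinnertonDyer.Theses.SelmerRank.SelmerRankUB →
    Summit.BirchSwinnertonDyer.BirchSwinnertonDyer.Theses.SelmerRank.SelmerRankSmallImage →
    Summit.BirchSwinnertonDyer.BirchSwinnertonDyer.Theses.SelmerRank.SelmerRankShaPFinite →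
    Summit.BirchSwinnertonDyer.BirchSwinnertonDyer.Theses.PAdicOrderV2.PAdicOrderSemisimpleR3 →
    Summit.BirchSwinnertonDyer.BirchSwinnertonDyer.Theses.PAdicOrderV2.PAdicOrderMainConjectureR7 →
    Literature.NumberTheory.EllipticCurves.Greenberg1999_coinvariantsRank_eq_selmerCorank_rat →
    (∀ (W : WeierstrassCurve ℚ) [W.IsElliptic] [W.IsGloballyMinimal] (p : ℕ) [Fact p.Prime],
      p = 2 → W.HasGoodReductionAtPrime p → ¬ (p : ℤ) ∣ W.frobeniusTrace p →
      ∀ (κ : Literature.NumberTheory.EllipticCurves.ZpExtension ℚ p) (γ : Field.absoluteGaloisGroup ℚ),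
        κ.IsCyclotomic → κ.IsTopGenerator γ →
        Literature.NumberTheory.EllipticCurves.IsCyclotomicVariable p γ →
      ∀ {N : ℕ} [NeZero N] (f : CuspForm (CongruenceSubgroup.Gamma0 N) 2),
        Literature.NumberTheory.EllipticCurves.ModularForms.IsNewformOf W f →
      ∀ (D : W.SelmerDualData κ γ),
        D.IsTorsion ∧
          ∃ (g : Literature.NumberTheory.EllipticCurves.IwasawaAlgebra p) (k : ℤ),
            D.charIdeal = Ideal.span {g} ∧
              Literature.NumberTheory.EllipticCurves.iwasawaToPowerSeries p g =
                PowerSeries.C ((p : ℚ_[p]) ^ k) *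
                  Literature.NumberTheory.EllipticCurves.padicLFunction f
                    (Literature.NumberTheory.EllipticCurves.unitRoot W p : ℚ_[p])) →
    (∀ (W : WeierstrassCurve ℚ) [W.IsElliptic] [W.IsGloballyMinimal] (p : ℕ) [Fact p.Prime],
      p = 2 → W.HasGoodReductionAtPrime p → ¬ (p : ℤ) ∣ W.frobeniusTrace p →
      ∀ (κ : Literature.NumberTheory.EllipticCurves.ZpExtension ℚ p) (γ : Field.absoluteGaloisGroup ℚ),
        κ.IsCyclotomic → κ.IsTopGenerator γ →
      ∀ (D : W.SelmerDualData κ γ) (x : D.X),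
        (∃ k : ℕ, (PowerSeries.C ((p : ℤ_[p]) ^ k) * PowerSeries.X ^ 2 :
            Literature.NumberTheory.EllipticCurves.IwasawaAlgebra p) • x = 0) →
          ∃ k : ℕ, (PowerSeries.C ((p : ℤ_[p]) ^ k) * PowerSeries.X :
            Literature.NumberTheory.EllipticCurves.IwasawaAlgebra p) • x = 0) →
    Summit.BirchSwinnertonDyer.BirchSwinnertonDyer.Theses.PAdicOrderV2.PAdicOrderComparisonR2 := by
  intro h5 hLB hUB hSI hSha hSS hMC hCT hMC2 hSS2 W _ _ p _ hord N _ f hf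
  by_cases hp2 : p = 2
  · exact order_eq_analyticRank_of_mc_ss_control hLB hUB hSI hSha hCT W p hord f
      (fun κ γ hκ hγ hγ' D => hMC2 W p hp2 hord.1 hord.2 κ γ hκ hγ hγ' f hf D)
      (fun κ γ hκ hγ D x hx => hSS2 W p hp2 hord.1 hord.2 κ γ hκ hγ D x hx)
  · exact pAdicOrderComparisonR2_odd_of_items h5 hLB hUB hSI hSha hSS hMC hCT W p hp2 hord f hf

end Summit.BirchSwinnertonDyer.BirchSwinnertonDyer.Theorems
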